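import Summits.CriticalPhenomena.Ising3DConformalLimit.Theorems.PlantedPinningMoebiusLimitExistsNonCoincidentPathConnected
import Summits.CriticalPhenomena.Ising3DConformalLimit.Theorems.PlantedPinningMoebiusLimitExistsGoodFrame
import Summits.CriticalPhenomena.Ising3DConformalLimit.Theorems.PlantedPinningMoebiusLimitExistsWardOfPointwise
import Summits.CriticalPhenomena.Ising3DConformalLimit.Theorems.PlantedPinningMoebiusLimitExistsPointwiseOfWard
import Summits.CriticalPhenomena.Ising3DConformalLimit.Theorems.EnergyNotSigmaSquaredMoebiusLimitExistsOneMapOneJetAnalyticity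
import Summits.CriticalPhenomena.Ising3DConformalLimit.Theorems.MoebiusLimitExists.Negative.MeshContinuity
import Literature.Probability.LatticeModels.CriticalScalingDimension
import Literature.Probability.LatticeModels.SCTWardIdentity
import HarnessLib

/-!
# LOCAL-TO-GLOBAL for the conformal Ward identities of Ising₃ scaling limits
(crux `MoebiusLimitExists`, stmt-CriticalPhenomena-1344, line `Sketch` v13/v14, lead prover-line-stmt-CriticalPhenomena-1344-c18-0;
THEOREM-ONLY, `--supports stmt-CriticalPhenomena-1344`)

Two new structural facts about every normalised non-degenerate Euclidean-invariant scale-covariant pointwise scaling limit `S` of the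
critical `ℤ³` Ising correlators (`ρ > 0` on `(0,1]`):

1. **`analyticOnNhd_limit` — every level `S n` is jointly REAL-ANALYTIC on the WHOLE configuration space `NonCoincident 3 n`.**
   The tree had analyticity only on the `B₃`-good configurations (`MoebiusLimitExistsOneMapOneJet.stub_nineMirrorAnalyticity`, p121553:
   Osterwalder–Schrader holomorphy in three lattice time directions + Bernstein's cross theorem).  `O(3)` invariance of the limit frees
   the domain from the lattice axes: rotate an arbitrary configuration into a good one (`stub_exists_goodFrame`, p156669) and pull back.
2. **`ward_of_localWard` — a weak special-conformal Ward identity (`K_b`, any weight) holding for the tests supported in SOME non-empty open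
   set of `n`-point configurations holds for ALL tests supported off the diagonals.**  On the analyticity domain the weak identity is the
   pointwise one `DS_n·K_b = 2Δ' σ_b S_n` (`stub_pointwise_of_ward` p156884 / `stub_ward_of_pointwise` p157117 — the `C¹` equivalence
   `SCTWardPointwise ⟺ SCTWardWeak` that `Literature/Probability/LatticeModels/SCTWardIdentity.lean` lists as missing); the defect is
   real-analytic on the path-connected (`stub_nonCoincident_pathConnected`, p156713) configuration space and vanishes on an open set, hence
   everywhere (identity theorem).

Consequence for the crux (file `…LocalWardTight.lean`): the registered residual 7⁗ (single-generator Ward identity at even levels `≥ 4`)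
is equivalent to its GERM form 7⁗_loc — the `K_{e₀}` identity near ONE configuration per even level.

References: Glimm–Jaffe 1987 §6.1 Thm 6.1.3, §19.7 [GlimmJaffe1987]; Di Francesco–Mathieu–Sénéchal 1997 §4.3.1 (4.51)–(4.54)
[FrancescoMathieuSenechal1997]; Streater–Wightman, *PCT, Spin and Statistics, and All That*, Thm 3-5 (analytic continuation of
identities for Wightman/Schwinger functions).  No definitions, no `sorry`.
-/

noncomputable section

open Filter Topology MeasureTheory Set Function
open Literature.Probability.LatticeModels Literature.MathematicalPhysics.QuantumFieldTheory
open EuclideanGeometry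
open Summit.CriticalPhenomena.Ising3DConformalLimit.MoebiusLimitExistsOneMapOneJet
  (GoodConfig mirrorNormals stub_nineMirrorAnalyticity single_mem_mirrorNormals linearIndependent_single)
open Summit.CriticalPhenomena.Ising3DConformalLimit.MoebiusLimitExistsSketchV13
  (stub_nonCoincident_pathConnected stub_exists_goodFrame stub_ward_of_pointwise stub_pointwise_of_ward)

namespace Summit.CriticalPhenomena.Ising3DConformalLimit.MoebiusLimitExistsLocalWard

/-! ## D1. Every Euclidean scale-covariant Ising₃ scaling limit is real-analytic on ALL non-coincident configurations -/

/-- **A rotated configuration is good**: if the projections of `x` on an orthonormal basis `u` are pairwise distinct,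
then `(u.repr xᵢ)ᵢ` — the configuration in the coordinates of `u` — lies in `GoodConfig n` for the coordinate
frame. [folklore] -/
theorem repr_mem_goodConfig {n : ℕ} {x : Fin n → (EuclideanSpace ℝ (Fin 3))} (hx : Function.Injective x)
    (u : OrthonormalBasis (Fin 3) ℝ (EuclideanSpace ℝ (Fin 3))) (hu : ∀ (a : Fin 3) (i j : Fin n), i ≠ j → inner ℝ (x i - x j) (u a) ≠ 0) :
    (fun i => (u.repr (x i) : (EuclideanSpace ℝ (Fin 3)))) ∈ GoodConfig n := by
  refine ⟨?_, fun a => EuclideanSpace.single a 1, linearIndependent_single, single_mem_mirrorNormals, ?_⟩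
  · rw [mem_nonCoincident]
    exact u.repr.injective.comp hx
  · intro a i j hij
    by_contra hne
    apply hu a i j hne
    have h1 : inner ℝ (u.repr (x i) : (EuclideanSpace ℝ (Fin 3))) (EuclideanSpace.single a (1:ℝ)) =
        inner ℝ (u.repr (x j) : (EuclideanSpace ℝ (Fin 3))) (EuclideanSpace.single a (1:ℝ)) := hij
    rw [EuclideanSpace.inner_single_right, EuclideanSpace.inner_single_right] at h1
    simp only [one_mul, OrthonormalBasis.repr_apply_apply, conj_trivial] at h1
    rw [inner_sub_left, sub_eq_zero, real_inner_comm (u a) (x i), real_inner_comm (u a) (x j)]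
    exact h1

/-- **Real-analyticity of Ising₃ scaling limits on all non-coincident configurations.**  Every normalised
non-degenerate Euclidean-invariant scale-covariant pointwise scaling limit of the critical `ℤ³` correlators
(`ρ > 0` on `(0,1]`) has all its levels `S n` jointly real-analytic on the whole of `NonCoincident 3 n`:
nine-mirror analyticity on the good configurations (`stub_nineMirrorAnalyticity`, Osterwalder–Schrader
holomorphy in three lattice time directions + Bernstein's cross theorem), transported to every configuration by
a rotation making it good (`stub_exists_goodFrame`) — `O(3)` invariance of the limit is the input that frees the
analyticity domain from the lattice axes. [cite: GlimmJaffe1987, §6.1 Thm 6.1.3] -/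
theorem analyticOnNhd_limit {ρ : ℝ → ℝ} {Δ : ℝ} {S : CorrFamily 3}
    (hρ : ∀ δ ∈ Set.Ioc (0:ℝ) 1, 0 < ρ δ) (hlim : HasPointwiseScalingLimit (criticalCorr 3) ρ S)
    (hnorm : ∀ n z, z ∉ NonCoincident 3 n → S n z = 0) (hnd : IsNondegenerateTwoPoint S)
    (heuc : IsEuclideanInvariant S) (hsc : IsScaleCovariant Δ S) :
    ∀ n, AnalyticOnNhd ℝ (S n) (NonCoincident 3 n) := by
  intro n x hx
  have hΔ : 0 < Δ := by
    have h := scalingDimension_mem_Icc_holds ρ Δ S hlim hsc hnd hρ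
    linarith [h.1]
  have hcont : ∀ n, ContinuousOn (S n) (NonCoincident 3 n) := LimitMeshContinuity.continuousOn_limit hlim
  have hgood := stub_nineMirrorAnalyticity ρ Δ S hρ hΔ hlim hnorm hnd heuc.1 hsc hcont n
  obtain ⟨u, hu⟩ := stub_exists_goodFrame n x ((mem_nonCoincident x).1 hx)
  -- `S n = S n ∘ û` by rotation invariance, and `û x` is good
  -- the diagonal action `R̂ : y ↦ (u.repr yᵢ)ᵢ` as a continuous linear map of configuration space
  set Rhat : (Fin n → (EuclideanSpace ℝ (Fin 3))) →L[ℝ] (Fin n → (EuclideanSpace ℝ (Fin 3))) := ContinuousLinearMap.pi fun i =>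
    (u.repr.toLinearIsometry.toContinuousLinearMap : (EuclideanSpace ℝ (Fin 3)) →L[ℝ] (EuclideanSpace ℝ (Fin 3))).comp (ContinuousLinearMap.proj i) with hRhat
  have hRhat_apply : ∀ y : Fin n → (EuclideanSpace ℝ (Fin 3)), Rhat y = fun i => (u.repr (y i) : (EuclideanSpace ℝ (Fin 3))) := fun y => rfl
  have hRx : Rhat x ∈ GoodConfig n := by
    rw [hRhat_apply]
    exact repr_mem_goodConfig ((mem_nonCoincident x).1 hx) u hu
  have hinv : S n = S n ∘ Rhat := by
    funext y
    rw [Function.comp_apply, hRhat_apply]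
    exact (heuc.2 n u.repr y).symm
  rw [hinv]
  exact (hgood (Rhat x) hRx).comp (Rhat.analyticAt x)

/-! ## D2. The pointwise special-conformal defect is real-analytic -/

/-- The special conformal vector field `K_b(x) = (‖xᵢ‖² b − 2⟪b,xᵢ⟫ xᵢ)ᵢ` is real-analytic (a polynomial map). [folklore] -/
theorem analyticAt_sctField (n : ℕ) (b : (EuclideanSpace ℝ (Fin 3))) (x : Fin n → (EuclideanSpace ℝ (Fin 3))) :
    AnalyticAt ℝ (fun y : Fin n → (EuclideanSpace ℝ (Fin 3)) => fun i => ‖y i‖ ^ 2 • b - (2 * inner ℝ b (y i)) • y i) x := by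
  have h : ContDiff ℝ (⊤ : WithTop ℕ∞)
      (fun y : Fin n → (EuclideanSpace ℝ (Fin 3)) => fun i => ‖y i‖ ^ 2 • b - (2 * inner ℝ b (y i)) • y i) := by
    refine contDiff_pi.2 fun i => ?_
    have hi : ContDiff ℝ (⊤ : WithTop ℕ∞) (fun y : Fin n → (EuclideanSpace ℝ (Fin 3)) => y i) := contDiff_apply ℝ (EuclideanSpace ℝ (Fin 3)) i
    exact ((hi.norm_sq ℝ).smul contDiff_const).sub ((contDiff_const.mul (contDiff_const.inner ℝ hi)).smul hi)
  exact h.analyticOnNhd x (Set.mem_univ x)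

/-- The linear functional `x ↦ Σᵢ ⟪b, xᵢ⟫` is real-analytic. [folklore] -/
theorem analyticAt_sumInner (n : ℕ) (b : (EuclideanSpace ℝ (Fin 3))) (x : Fin n → (EuclideanSpace ℝ (Fin 3))) :
    AnalyticAt ℝ (fun y : Fin n → (EuclideanSpace ℝ (Fin 3)) => ∑ i, inner ℝ b (y i)) x := by
  have h : ContDiff ℝ (⊤ : WithTop ℕ∞) (fun y : Fin n → (EuclideanSpace ℝ (Fin 3)) => ∑ i, inner ℝ b (y i)) :=
    ContDiff.sum fun i _ => contDiff_const.inner ℝ (contDiff_apply ℝ (EuclideanSpace ℝ (Fin 3)) i)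
  exact h.analyticOnNhd x (Set.mem_univ x)

/-- **The pointwise `K_b` defect `x ↦ DF(x)·K_b(x) − 2Δ (Σᵢ ⟪b,xᵢ⟫) F(x)` of a real-analytic level is real-analytic.** [folklore] -/
theorem analyticOnNhd_defect {n : ℕ} {F : (Fin n → (EuclideanSpace ℝ (Fin 3))) → ℝ} {U : Set (Fin n → (EuclideanSpace ℝ (Fin 3)))} (hF : AnalyticOnNhd ℝ F U)
    (Δ : ℝ) (b : (EuclideanSpace ℝ (Fin 3))) :
    AnalyticOnNhd ℝ (fun x => fderiv ℝ F x (fun i => ‖x i‖ ^ 2 • b - (2 * inner ℝ b (x i)) • x i) -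
      2 * Δ * (∑ i, inner ℝ b (x i)) * F x) U := by
  intro x hx
  have h1 : AnalyticAt ℝ (fderiv ℝ F) x := hF.fderiv x hx
  have hev : AnalyticAt ℝ (fun p : ((Fin n → (EuclideanSpace ℝ (Fin 3))) →L[ℝ] ℝ) × (Fin n → (EuclideanSpace ℝ (Fin 3))) => p.1 p.2)
      (fderiv ℝ F x, (fun i => ‖x i‖ ^ 2 • b - (2 * inner ℝ b (x i)) • x i)) :=
    (ContinuousLinearMap.id ℝ ((Fin n → (EuclideanSpace ℝ (Fin 3))) →L[ℝ] ℝ)).analyticAt_bilinear _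
  exact (hev.comp₂ h1 (analyticAt_sctField n b x)).sub
    ((analyticAt_const.mul (analyticAt_sumInner n b x)).mul (hF x hx))

/-! ## D3. LOCAL-TO-GLOBAL: a weak `K_b` Ward identity near one configuration propagates to all configurations -/

/-- **Local-to-global for the conformal Ward identities of Ising₃ scaling limits.**  Let `S` be a normalised
non-degenerate Euclidean-invariant scale-covariant pointwise scaling limit of the critical `ℤ³` correlators and fix a
level `n`, a generator `b` and a weight `Δ'`.  If the weak `K_b` Ward identity with weight `Δ'` holds for all smooth
tests compactly supported in SOME non-empty open set `V` of non-coincident configurations, then it holds for all smooth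
tests compactly supported off the diagonals.  Proof: `S n` is real-analytic on `NonCoincident 3 n` (D1), so the weak
identity on `V` is the pointwise identity `DS_n·K_b = 2Δ' σ_b S_n` on `V` (C2); the defect is real-analytic (D2) on the
connected (P1) set `NonCoincident 3 n` and vanishes on `V`, hence everywhere (identity theorem), and the pointwise
identity integrates back to the weak one (C1). [cite: GlimmJaffe1987, §6.1 Thm 6.1.3] -/
theorem ward_of_localWard {ρ : ℝ → ℝ} {Δ : ℝ} {S : CorrFamily 3}
    (hρ : ∀ δ ∈ Set.Ioc (0:ℝ) 1, 0 < ρ δ) (hlim : HasPointwiseScalingLimit (criticalCorr 3) ρ S)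
    (hnorm : ∀ n z, z ∉ NonCoincident 3 n → S n z = 0) (hnd : IsNondegenerateTwoPoint S)
    (heuc : IsEuclideanInvariant S) (hsc : IsScaleCovariant Δ S)
    {n : ℕ} (Δ' : ℝ) (b : (EuclideanSpace ℝ (Fin 3))) {V : Set (Fin n → (EuclideanSpace ℝ (Fin 3)))} (hV : IsOpen V) (hVne : V.Nonempty)
    (hVsub : V ⊆ NonCoincident 3 n)
    (hloc : ∀ (φ : (Fin n → (EuclideanSpace ℝ (Fin 3))) → ℝ), ContDiff ℝ ((⊤ : ℕ∞) : WithTop ℕ∞) φ → HasCompactSupport φ →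
      tsupport φ ⊆ V →
      ∫ x, S n x * ((2 * Δ' - 6) * (∑ i, inner ℝ b (x i)) * φ x +
        fderiv ℝ φ x (fun i => ‖x i‖ ^ 2 • b - (2 * inner ℝ b (x i)) • x i)) = 0) :
    ∀ (φ : (Fin n → (EuclideanSpace ℝ (Fin 3))) → ℝ), ContDiff ℝ ((⊤ : ℕ∞) : WithTop ℕ∞) φ → HasCompactSupport φ →
      tsupport φ ⊆ NonCoincident 3 n →
      ∫ x, S n x * ((2 * Δ' - 6) * (∑ i, inner ℝ b (x i)) * φ x +
        fderiv ℝ φ x (fun i => ‖x i‖ ^ 2 • b - (2 * inner ℝ b (x i)) • x i)) = 0 := by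
  have han : AnalyticOnNhd ℝ (S n) (NonCoincident 3 n) := analyticOnNhd_limit hρ hlim hnorm hnd heuc hsc n
  -- C2 on `V`
  have hEV := stub_pointwise_of_ward n (S n) Δ' b V hV (han.mono hVsub) hloc
  -- the defect is analytic on the connected set `NonCoincident 3 n` and vanishes on `V`
  set D : (Fin n → (EuclideanSpace ℝ (Fin 3))) → ℝ := fun x => fderiv ℝ (S n) x (fun i => ‖x i‖ ^ 2 • b - (2 * inner ℝ b (x i)) • x i) -
      2 * Δ' * (∑ i, inner ℝ b (x i)) * S n x with hD
  have hDan : AnalyticOnNhd ℝ D (NonCoincident 3 n) := analyticOnNhd_defect han Δ' b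
  obtain ⟨z₀, hz₀⟩ := hVne
  have hDz : D =ᶠ[𝓝 z₀] 0 := by
    filter_upwards [hV.mem_nhds hz₀] with x hx
    simp only [hD, Pi.zero_apply, sub_eq_zero]
    exact hEV x hx
  have hD0 : EqOn D 0 (NonCoincident 3 n) :=
    hDan.eqOn_zero_of_preconnected_of_eventuallyEq_zero
      (stub_nonCoincident_pathConnected n).isConnected.isPreconnected (hVsub hz₀) hDz
  -- C1 on `NonCoincident 3 n`
  refine stub_ward_of_pointwise n (S n) Δ' b (NonCoincident 3 n) (isOpen_nonCoincident 3 n) han ?_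
  intro x hx
  have := hD0 hx
  simp only [hD, Pi.zero_apply, sub_eq_zero] at this
  exact this


/-! ## Level-wise corollary: a local weak Ward identity for every generator is `SCTWardWeak` -/

/-- **Local Ward identities at one level give `SCTWardWeak` at that level**: if for every generator `b` the weak `K_b` identity with
weight `Δ'` holds near some configuration, then `SCTWardWeak S Δ' n`. [cite: FrancescoMathieuSenechal1997, §4.3.1 (4.51)–(4.54)] -/
theorem sctWardWeak_of_localWard {ρ : ℝ → ℝ} {Δ : ℝ} {S : CorrFamily 3}
    (hρ : ∀ δ ∈ Set.Ioc (0:ℝ) 1, 0 < ρ δ) (hlim : HasPointwiseScalingLimit (criticalCorr 3) ρ S)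
    (hnorm : ∀ n z, z ∉ NonCoincident 3 n → S n z = 0) (hnd : IsNondegenerateTwoPoint S)
    (heuc : IsEuclideanInvariant S) (hsc : IsScaleCovariant Δ S) {n : ℕ} (Δ' : ℝ)
    (hloc : ∀ b : (EuclideanSpace ℝ (Fin 3)), ∃ V : Set (Fin n → (EuclideanSpace ℝ (Fin 3))), IsOpen V ∧ V.Nonempty ∧ V ⊆ NonCoincident 3 n ∧
      ∀ (φ : (Fin n → (EuclideanSpace ℝ (Fin 3))) → ℝ), ContDiff ℝ ((⊤ : ℕ∞) : WithTop ℕ∞) φ → HasCompactSupport φ → tsupport φ ⊆ V →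
        ∫ x, S n x * ((2 * Δ' - 6) * (∑ i, inner ℝ b (x i)) * φ x +
          fderiv ℝ φ x (fun i => ‖x i‖ ^ 2 • b - (2 * inner ℝ b (x i)) • x i)) = 0) :
    SCTWardWeak S Δ' n := by
  rw [sctWardWeak_iff_coeff S Δ' n (κ := 2 * Δ' - 6) (by push_cast; ring)]
  intro b φ hφ hφc hφU
  obtain ⟨V, hV, hVne, hVsub, hV'⟩ := hloc b
  exact ward_of_localWard hρ hlim hnorm hnd heuc hsc Δ' b hV hVne hVsub hV' φ hφ hφc hφU

/-! ## Registered anchor -/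

/-- **Registered anchor of this file — real-analyticity of every Euclidean scale-covariant Ising₃ scaling limit on all non-coincident
configurations** (explicit-binder form of `analyticOnNhd_limit`). [cite: GlimmJaffe1987, §6.1 Thm 6.1.3] -/
theorem limit_analyticOnNhd_nonCoincident : ∀ (ρ : ℝ → ℝ) (Δ : ℝ) (S : Literature.Probability.LatticeModels.CorrFamily 3), (∀ δ ∈ Set.Ioc (0:ℝ) 1, 0 < ρ δ) → Literature.Probability.LatticeModels.HasPointwiseScalingLimit (Literature.Probability.LatticeModels.criticalCorr 3) ρ S → (∀ n z, z ∉ Literature.Probability.LatticeModels.NonCoincident 3 n → S n z = 0) → Literature.Probability.LatticeModels.IsNondegenerateTwoPoint S → Literature.Probability.LatticeModels.IsEuclideanInvariant S → Literature.Probability.LatticeModels.IsScaleCovariant Δ S → ∀ n : ℕ, AnalyticOnNhd ℝ (S n) (Literature.Probability.LatticeModels.NonCoincident 3 n) :=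
  fun _ _ _ hρ hlim hnorm hnd heuc hsc => analyticOnNhd_limit hρ hlim hnorm hnd heuc hsc

end Summit.CriticalPhenomena.Ising3DConformalLimit.MoebiusLimitExistsLocalWard

end
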